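import Summits.PneNP.PneNP.Theses.KarlinRubin
import Summits.PneNP.PneNP.Theorems.KarlinRubinMonotoneSufficesLightCone
import Literature.Computability.AlgebraicComplexity.RandomRestrictionCounting
import Literature.Probability.RandomGraphs.ErdosRenyiCylinder

/-!
# Route KarlinRubin — `MonotoneSuffices` (stmt-PneNP-18026): the locality barrier

The hypothesis of `MonotoneSuffices` at budget `s` asks for a family of `B₂`-circuits of size
`≤ s(n)` whose type-I error on `G(n,1/2)` plus type-II error on the planted `⌈n^{1/2-δ}⌉`-clique
tends to `0`. A `B₂`-circuit with `s` gates reads at most `2s + 1` edge slots, and a planted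
`k`-set meets a fixed edge slot with both endpoints with probability `≤ k²/n²`; off that event the
planted graph agrees with the ambient `G(n,1/2)` sample on every slot the circuit reads. Hence
(type I) + (type II) `≥ 1 - (2s+1)·k²/n²` (`plantedClique_errSum_locality`,
`circuit_card_lightCone_le_of_isOver_B2`, file `KarlinRubinMonotoneSufficesLightCone.lean`), so NO family of size `s(n) = o(n^{1+2δ})` strongly
detects (`karlinRubin_no_detector_of_small_budget`), and the implication `MonotoneSuffices` holds
vacuously for every such budget and every exponent `a`
(`karlinRubin_monotoneSuffices_of_small_budget`). Together with the brute-force monotone clique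
search (budgets `≥ n^{3 log₂ n + O(1)}`) this brackets the genuinely open range of the item,
`n^{1+2δ} ≲ s ≲ n^{O(log n)}`. Helpers for stmt-PneNP-18026 (`--supports`).
-/

set_option linter.dupNamespace false -- `Summit.PneNP.PneNP.…`: summit = sub-problem name (D-0017 single-conjunct layout)


namespace Summit.PneNP.PneNP.Theorems

open Filter Topology Finset
open scoped ENNReal
open Literature.Computability.Complexity Literature.Probability.RandomGraphs.PlantedClique

/-- Planting on `S` does not touch an edge slot not inside `S`. [folklore] -/
theorem plant_apply_of_not_inside {n : ℕ} (S : Finset (Fin n)) (x : EdgeVec n)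
    (e : (⊤ : SimpleGraph (Fin n)).edgeSet) (he : ¬ ∀ v ∈ (e : Sym2 (Fin n)), v ∈ S) :
    plant S x e = x e := by
  classical
  simp [plant, he]

/-- **A planted `k`-set covers a fixed edge slot with probability `≤ k²/n²`**: among the
`min k n`-subsets of `Fin n`, the fraction containing both endpoints of a fixed edge of `Kₙ` is
`C(n-2, d-2)/C(n, d) ≤ d²/n²` (`d = min k n`; Kumar–Saraf row count
`card_powersetCard_filter_superset_mul_le`). [folklore] -/
theorem uniform_kSubsets_inside_le {n k : ℕ} (e : (⊤ : SimpleGraph (Fin n)).edgeSet) :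
    (PMF.uniformOfFinset (kSubsets n k) (kSubsets_nonempty n k)).toOuterMeasure
        {S | ∀ v ∈ (e : Sym2 (Fin n)), v ∈ S}
      ≤ ((min k n : ℕ) : ℝ≥0∞) ^ 2 / (n : ℝ≥0∞) ^ 2 := by
  classical
  obtain ⟨e, he⟩ := e
  induction e using Sym2.ind with
  | _ a b =>
    have hab : a ≠ b := by simpa [SimpleGraph.mem_edgeSet] using he
    set d := min k n with hd
    set FA : Finset (Finset (Fin n)) :=
      (powersetCard d (univ : Finset (Fin n))).filter fun S => ({a, b} : Finset (Fin n)) ⊆ S with hFA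
    have hKS := Literature.Computability.AlgebraicComplexity.KumarSaraf.card_powersetCard_filter_superset_mul_le
      (univ : Finset (Fin n)) ({a, b} : Finset (Fin n)) d
    rw [Finset.card_univ, Fintype.card_fin, Finset.card_pair hab] at hKS
    have hcardks : #(kSubsets n k) = n.choose d := by
      rw [kSubsets, ← hd, Finset.card_powersetCard, Finset.card_univ, Fintype.card_fin]
    have hchoose_pos : 0 < n.choose d := Nat.choose_pos (min_le_right k n)
    have hn0 : (n : ℝ≥0∞) ^ 2 ≠ 0 := pow_ne_zero _ (by exact_mod_cast (Fin.pos a).ne')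
    have hntop : (n : ℝ≥0∞) ^ 2 ≠ ⊤ := ENNReal.pow_ne_top (ENNReal.natCast_ne_top n)
    rw [PMF.toOuterMeasure_uniformOfFinset_apply, hcardks,
      ENNReal.div_le_iff (by exact_mod_cast hchoose_pos.ne') (ENNReal.natCast_ne_top _)]
    refine le_trans (b := ((#FA : ℕ) : ℝ≥0∞)) ?_ ?_
    · exact_mod_cast Finset.card_le_card fun S hS => by
        simp only [Finset.mem_filter, Set.mem_setOf_eq] at hS
        rw [hFA, Finset.mem_filter, kSubsets.eq_1] at *
        refine ⟨by simpa [hd] using hS.1, ?_⟩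
        intro v hv
        simp only [Finset.mem_insert, Finset.mem_singleton] at hv
        rcases hv with rfl | rfl
        · exact hS.2 _ (Sym2.mem_mk_left _ _)
        · exact hS.2 _ (Sym2.mem_mk_right _ _)
    · have hcast : ((#FA : ℕ) : ℝ≥0∞) * (n : ℝ≥0∞) ^ 2 ≤ ((d ^ 2 * n.choose d : ℕ) : ℝ≥0∞) := by
        exact_mod_cast (hKS.trans_eq (mul_comm _ _))
      have h1 : ((#FA : ℕ) : ℝ≥0∞) ≤ ((d ^ 2 * n.choose d : ℕ) : ℝ≥0∞) / (n : ℝ≥0∞) ^ 2 :=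
        (ENNReal.le_div_iff_mul_le (Or.inl hn0) (Or.inl hntop)).2 hcast
      refine h1.trans (le_of_eq ?_)
      push_cast
      rw [div_eq_mul_inv, div_eq_mul_inv]
      ring

/-- **Locality of the planted-clique pair.** If a test `f` on edge vectors of `Kₙ` only depends on
the edge slots in `R`, then its type-I error on `G(n,1/2)` plus its type-II error on the planted
`k`-clique distribution is at least `1 - |R|·d²/n²` (`d = min k n`): conditioned on the planted
set avoiding every slot of `R` (probability `≥ 1 - |R| d²/n²`) the planted graph and the ambient
`G(n,1/2)` sample agree on `R`. Stated additively in `ℝ≥0∞`. [folklore] -/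
theorem plantedClique_errSum_locality {n k : ℕ} (R : Finset ((⊤ : SimpleGraph (Fin n)).edgeSet))
    (f : EdgeVec n → Bool) (hf : ∀ x y : EdgeVec n, (∀ e ∈ R, x e = y e) → f x = f y) :
    1 ≤ (erdosRenyiHalf n).toOuterMeasure {x | f x = true} +
        (plantedCliqueDist n k).toOuterMeasure {x | f x = false} +
        (R.card : ℝ≥0∞) * (((min k n : ℕ) : ℝ≥0∞) ^ 2 / (n : ℝ≥0∞) ^ 2) := by
  classical
  set P0 := erdosRenyiHalf n with hP0
  set u := PMF.uniformOfFinset (kSubsets n k) (kSubsets_nonempty n k) with hu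
  set bad : Set (Finset (Fin n)) := {S | ∃ e ∈ R, ∀ v ∈ (e : Sym2 (Fin n)), v ∈ S} with hbad
  have hAc : {x : EdgeVec n | f x = false} = {x | f x = true}ᶜ := by
    ext x; simp
  -- (1) the planted measure of `{f = false}`, fibred over the planted set
  have hP1 : (plantedCliqueDist n k).toOuterMeasure {x | f x = false} =
      ∑' S, u S * P0.toOuterMeasure {x | f (plant S x) = false} := by
    rw [plantedCliqueDist, PMF.toOuterMeasure_map_apply, plantedCliqueJoint,
      PMF.toOuterMeasure_bind_apply]
    refine tsum_congr fun S => ?_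
    rw [PMF.toOuterMeasure_map_apply]
    rfl
  -- (2) a planted set inside no slot of `R` leaves `f` unchanged
  have hgood : ∀ S, S ∉ bad → {x : EdgeVec n | f (plant S x) = false} = {x | f x = false} := by
    intro S hS
    ext x
    simp only [Set.mem_setOf_eq]
    rw [hf (plant S x) x fun e he => plant_apply_of_not_inside S x e fun h => hS ⟨e, he, h⟩]
  -- (3) `P0{f = false} · u(good) ≤ P1{f = false}`
  have h3 : P0.toOuterMeasure {x | f x = false} * u.toOuterMeasure badᶜ ≤
      (plantedCliqueDist n k).toOuterMeasure {x | f x = false} := by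
    rw [hP1, PMF.toOuterMeasure_apply u badᶜ, ← ENNReal.tsum_mul_left]
    refine ENNReal.tsum_le_tsum fun S => ?_
    by_cases hS : S ∈ bad
    · rw [Set.indicator_of_notMem (show S ∉ badᶜ from fun h => h hS)]
      simp
    · rw [Set.indicator_of_mem (show S ∈ badᶜ from hS), hgood S hS, mul_comm]
  -- (4) union bound: `u(bad) ≤ |R| · d² / n²`
  have h4 : u.toOuterMeasure bad ≤
      (R.card : ℝ≥0∞) * (((min k n : ℕ) : ℝ≥0∞) ^ 2 / (n : ℝ≥0∞) ^ 2) := by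
    have hU : bad = ⋃ e ∈ R, {S : Finset (Fin n) | ∀ v ∈ (e : Sym2 (Fin n)), v ∈ S} := by
      ext S
      simp [hbad]
    rw [hU]
    calc u.toOuterMeasure (⋃ e ∈ R, {S : Finset (Fin n) | ∀ v ∈ (e : Sym2 (Fin n)), v ∈ S})
        ≤ ∑ e ∈ R, u.toOuterMeasure {S : Finset (Fin n) | ∀ v ∈ (e : Sym2 (Fin n)), v ∈ S} :=
          MeasureTheory.measure_biUnion_finset_le R _
      _ ≤ ∑ _e ∈ R, (((min k n : ℕ) : ℝ≥0∞) ^ 2 / (n : ℝ≥0∞) ^ 2) :=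
          Finset.sum_le_sum fun e _ => uniform_kSubsets_inside_le e
      _ = (R.card : ℝ≥0∞) * (((min k n : ℕ) : ℝ≥0∞) ^ 2 / (n : ℝ≥0∞) ^ 2) := by
          rw [Finset.sum_const, nsmul_eq_mul]
  -- (5) assemble
  have hc0 : P0.toOuterMeasure {x | f x = true} + P0.toOuterMeasure {x | f x = false} = 1 := by
    rw [hAc]; exact P0.toOuterMeasure_add_compl _
  have hcu : u.toOuterMeasure badᶜ + u.toOuterMeasure bad = 1 := by
    rw [add_comm]; exact u.toOuterMeasure_add_compl bad
  have hle1 : P0.toOuterMeasure {x | f x = false} ≤ 1 :=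
    calc P0.toOuterMeasure {x | f x = false}
        ≤ P0.toOuterMeasure {x | f x = true} + P0.toOuterMeasure {x | f x = false} := le_add_self
      _ = 1 := hc0
  calc (1 : ℝ≥0∞) = P0.toOuterMeasure {x | f x = true} +
        P0.toOuterMeasure {x | f x = false} * (u.toOuterMeasure badᶜ + u.toOuterMeasure bad) := by
        rw [hcu, mul_one, hc0]
    _ = P0.toOuterMeasure {x | f x = true} +
        (P0.toOuterMeasure {x | f x = false} * u.toOuterMeasure badᶜ +
          P0.toOuterMeasure {x | f x = false} * u.toOuterMeasure bad) := by rw [mul_add]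
    _ ≤ P0.toOuterMeasure {x | f x = true} +
        ((plantedCliqueDist n k).toOuterMeasure {x | f x = false} + 1 * u.toOuterMeasure bad) := by
        exact add_le_add le_rfl (add_le_add h3 (mul_le_mul_left hle1 _))
    _ ≤ P0.toOuterMeasure {x | f x = true} +
        ((plantedCliqueDist n k).toOuterMeasure {x | f x = false} +
          (R.card : ℝ≥0∞) * (((min k n : ℕ) : ℝ≥0∞) ^ 2 / (n : ℝ≥0∞) ^ 2)) := by
        rw [one_mul]
        gcongr
    _ = _ := by rw [add_assoc]

/-- **No small circuit family strongly detects a planted clique (locality barrier).** For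
`0 < δ < 1/2` and any budget `s(n) = o(n^{1+2δ})`, no family of `B₂`-circuits of size `≤ s(n)`
(eventually) has type-I error on `G(n,1/2)` plus type-II error on the planted
`⌈n^{1/2-δ}⌉`-clique tending to `0`: a `B₂`-circuit with `s` gates reads `≤ 2s+1` edge slots and
`plantedClique_errSum_locality` bounds the error sum below by `1 - (2s+1)·4n^{1-2δ}/n² → 1`.
[folklore] -/
theorem karlinRubin_no_detector_of_small_budget {δ : ℝ} (hδ : 0 < δ) (hδ' : δ < 1 / 2)
    (s : ℕ → ℕ) (hs : Tendsto (fun n : ℕ => (s n : ℝ) / (n : ℝ) ^ (1 + 2 * δ)) atTop (nhds 0)) :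
    ¬ ∃ C : (n : ℕ) → Circuit ((⊤ : SimpleGraph (Fin n)).edgeSet),
        (∀ᶠ n : ℕ in atTop, (C n).IsOver B2 ∧ (C n).size ≤ s n) ∧
        Tendsto (fun n : ℕ => (erdosRenyiHalf n).toOuterMeasure {x | (C n).eval x = true} +
          (plantedCliqueDist n ⌈(n : ℝ) ^ (1 / 2 - δ)⌉₊).toOuterMeasure {x | (C n).eval x = false})
          atTop (nhds 0) := by
  classical
  rintro ⟨C, hC, hT⟩
  set k : ℕ → ℕ := fun n => ⌈(n : ℝ) ^ (1 / 2 - δ)⌉₊ with hk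
  -- the real-valued error budget `r n = (2 s n + 1) · d(n)² / n²`, `d(n) = min (k n) n`
  set r : ℕ → ℝ := fun n => ((2 * s n + 1 : ℕ) : ℝ) * (((min (k n) n : ℕ) : ℝ) ^ 2 / (n : ℝ) ^ 2)
    with hr
  -- (a) `r → 0`
  have hr0 : Tendsto r atTop (nhds 0) := by
    have hpow : Tendsto (fun n : ℕ => (n : ℝ) ^ (1 + 2 * δ)) atTop atTop :=
      (tendsto_rpow_atTop (by linarith)).comp tendsto_natCast_atTop_atTop
    have hmaj : Tendsto (fun n : ℕ => 8 * ((s n : ℝ) / (n : ℝ) ^ (1 + 2 * δ)) +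
        4 / (n : ℝ) ^ (1 + 2 * δ)) atTop (nhds 0) := by
      have h1 := hs.const_mul 8
      have h2 : Tendsto (fun n : ℕ => (4 : ℝ) / (n : ℝ) ^ (1 + 2 * δ)) atTop (nhds 0) :=
        tendsto_const_nhds.div_atTop hpow
      simpa using h1.add h2
    refine squeeze_zero' (Eventually.of_forall fun n => by positivity) ?_ hmaj
    filter_upwards [eventually_ge_atTop 1] with n hn1
    have hnpos : (0 : ℝ) < n := by exact_mod_cast hn1
    have hβ : (0 : ℝ) ≤ 1 / 2 - δ := by linarith
    have hone : (1 : ℝ) ≤ (n : ℝ) ^ (1 / 2 - δ) := Real.one_le_rpow (by exact_mod_cast hn1) hβ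
    have hd : (((min (k n) n : ℕ)) : ℝ) ≤ 2 * (n : ℝ) ^ (1 / 2 - δ) := by
      have h1 : (((min (k n) n : ℕ)) : ℝ) ≤ (k n : ℝ) := by exact_mod_cast min_le_left (k n) n
      have h2 : (k n : ℝ) < (n : ℝ) ^ (1 / 2 - δ) + 1 :=
        Nat.ceil_lt_add_one (Real.rpow_nonneg hnpos.le _)
      linarith
    have hd2 : (((min (k n) n : ℕ)) : ℝ) ^ 2 ≤ 4 * (n : ℝ) ^ (1 - 2 * δ) := by
      have hsq : ((n : ℝ) ^ (1 / 2 - δ)) ^ 2 = (n : ℝ) ^ (1 - 2 * δ) := by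
        rw [← Real.rpow_mul_natCast hnpos.le]
        norm_num
        ring_nf
      calc (((min (k n) n : ℕ)) : ℝ) ^ 2 ≤ (2 * (n : ℝ) ^ (1 / 2 - δ)) ^ 2 := by
            gcongr
        _ = 4 * (n : ℝ) ^ (1 - 2 * δ) := by rw [mul_pow, hsq]; norm_num
    have hsplit : (n : ℝ) ^ 2 = (n : ℝ) ^ (1 - 2 * δ) * (n : ℝ) ^ (1 + 2 * δ) := by
      rw [← Real.rpow_add hnpos, show (1 - 2 * δ) + (1 + 2 * δ) = ((2 : ℕ) : ℝ) by push_cast; ring,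
        Real.rpow_natCast]
    have hp1 : (0 : ℝ) < (n : ℝ) ^ (1 - 2 * δ) := Real.rpow_pos_of_pos hnpos _
    have hp2 : (0 : ℝ) < (n : ℝ) ^ (1 + 2 * δ) := Real.rpow_pos_of_pos hnpos _
    calc r n = ((2 * s n + 1 : ℕ) : ℝ) * (((min (k n) n : ℕ) : ℝ) ^ 2 / (n : ℝ) ^ 2) := rfl
      _ ≤ ((2 * s n + 1 : ℕ) : ℝ) * (4 * (n : ℝ) ^ (1 - 2 * δ) / (n : ℝ) ^ 2) := by
          gcongr
      _ = (8 * (s n : ℝ) + 4) / (n : ℝ) ^ (1 + 2 * δ) := by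
          rw [hsplit]
          field_simp
          push_cast
          ring
      _ = 8 * ((s n : ℝ) / (n : ℝ) ^ (1 + 2 * δ)) + 4 / (n : ℝ) ^ (1 + 2 * δ) := by
          field_simp
  -- (b) eventually `1 ≤ errSum n + r n`
  have hev : ∀ᶠ n : ℕ in atTop, (1 : ℝ≥0∞) ≤
      ((erdosRenyiHalf n).toOuterMeasure {x | (C n).eval x = true} +
        (plantedCliqueDist n ⌈(n : ℝ) ^ (1 / 2 - δ)⌉₊).toOuterMeasure {x | (C n).eval x = false}) +
      ENNReal.ofReal (r n) := by
    filter_upwards [hC, eventually_ge_atTop 1] with n hCn hn1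
    have hloc := plantedClique_errSum_locality (k := k n) (C n).lightCone (fun x => (C n).eval x)
      (fun x y hxy => (C n).eval_congr_lightCone hxy)
    have hcard : ((C n).lightCone.card : ℝ≥0∞) ≤ ((2 * s n + 1 : ℕ) : ℝ≥0∞) := by
      have h1 := circuit_card_lightCone_le_of_isOver_B2 (C n) hCn.1
      have h2 : 2 * (C n).size + 1 ≤ 2 * s n + 1 := by have := hCn.2; omega
      exact_mod_cast h1.trans h2
    have hofReal : ((2 * s n + 1 : ℕ) : ℝ≥0∞) * ((((min (k n) n : ℕ)) : ℝ≥0∞) ^ 2 / (n : ℝ≥0∞) ^ 2) =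
        ENNReal.ofReal (r n) := by
      have hnpos : (0 : ℝ) < (n : ℝ) ^ 2 := by positivity
      rw [hr]
      simp only
      rw [ENNReal.ofReal_mul (by positivity), ENNReal.ofReal_natCast,
        ENNReal.ofReal_div_of_pos hnpos, ENNReal.ofReal_pow (by positivity),
        ENNReal.ofReal_pow (by positivity), ENNReal.ofReal_natCast, ENNReal.ofReal_natCast]
    calc (1 : ℝ≥0∞) ≤ _ := hloc
      _ ≤ ((erdosRenyiHalf n).toOuterMeasure {x | (C n).eval x = true} +
            (plantedCliqueDist n (k n)).toOuterMeasure {x | (C n).eval x = false}) +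
          ((2 * s n + 1 : ℕ) : ℝ≥0∞) * ((((min (k n) n : ℕ)) : ℝ≥0∞) ^ 2 / (n : ℝ≥0∞) ^ 2) := by
          gcongr
      _ = _ := by rw [hofReal]
  -- (c) but `errSum n + r n → 0`
  have hsum : Tendsto (fun n : ℕ =>
      ((erdosRenyiHalf n).toOuterMeasure {x | (C n).eval x = true} +
        (plantedCliqueDist n ⌈(n : ℝ) ^ (1 / 2 - δ)⌉₊).toOuterMeasure {x | (C n).eval x = false}) +
      ENNReal.ofReal (r n)) atTop (nhds 0) := by
    have h2 : Tendsto (fun n => ENNReal.ofReal (r n)) atTop (nhds 0) := by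
      rw [← ENNReal.ofReal_zero]
      exact ENNReal.tendsto_ofReal hr0
    simpa using hT.add h2
  obtain ⟨n, hn1, hn2⟩ := (hev.and (hsum.eventually (gt_mem_nhds zero_lt_one))).exists
  exact absurd hn1 (not_le.2 hn2)

/-- **`MonotoneSuffices` below the locality barrier.** For `0 < δ < 1/2`, every exponent `a` and
every budget `s(n) = o(n^{1+2δ})`, the implication asserted by
`Summit.PneNP.PneNP.Theses.KarlinRubin.MonotoneSuffices` at `(δ, a, s)` holds — vacuously, by
`karlinRubin_no_detector_of_small_budget`. The item is therefore decided outside the range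
`n^{1+2δ} ≲ s(n)`. [folklore] -/
theorem karlinRubin_monotoneSuffices_of_small_budget {δ : ℝ} (hδ : 0 < δ) (hδ' : δ < 1 / 2)
    (a : ℕ) (s : ℕ → ℕ)
    (hs : Tendsto (fun n : ℕ => (s n : ℝ) / (n : ℝ) ^ (1 + 2 * δ)) atTop (nhds 0)) :
    (∃ C : (n : ℕ) → Circuit ((⊤ : SimpleGraph (Fin n)).edgeSet),
        (∀ᶠ n : ℕ in atTop, (C n).IsOver B2 ∧ (C n).size ≤ s n) ∧
        Tendsto (fun n : ℕ => (erdosRenyiHalf n).toOuterMeasure {x | (C n).eval x = true} +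
          (plantedCliqueDist n ⌈(n : ℝ) ^ (1 / 2 - δ)⌉₊).toOuterMeasure {x | (C n).eval x = false})
          atTop (nhds 0)) →
    ∃ C' : (n : ℕ) → Circuit ((⊤ : SimpleGraph (Fin n)).edgeSet),
        (∀ᶠ n : ℕ in atTop, (C' n).IsOver monotoneBasis01 ∧ (C' n).size ≤ (s n + n) ^ a) ∧
        Tendsto (fun n : ℕ => (erdosRenyiHalf n).toOuterMeasure {x | (C' n).eval x = true} +
          (plantedCliqueDist n ⌈(n : ℝ) ^ (1 / 2 - δ)⌉₊).toOuterMeasure {x | (C' n).eval x = false})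
          atTop (nhds 0) :=
  fun h => absurd h (karlinRubin_no_detector_of_small_budget hδ hδ' s hs)

/-- **stub_localityBarrier** (registered sub-goal of stmt-PneNP-18026; a side result, not a stub of the
`slice-transport` composition): for `0 < δ < 1/2` and every budget `s(n) = o(n^{1+2δ})`, NO family of
`B₂`-circuits of size `≤ s(n)` strongly detects the planted `⌈n^{1/2-δ}⌉`-clique
(`karlinRubin_no_detector_of_small_budget`). [folklore] -/
theorem stub_localityBarrier :
    ∀ δ : ℝ, 0 < δ → δ < 1 / 2 → ∀ s : ℕ → ℕ, Tendsto (fun n : ℕ => (s n : ℝ) / (n : ℝ) ^ (1 + 2 * δ)) atTop (nhds 0) → ¬ ∃ C : (n : ℕ) → Circuit ((⊤ : SimpleGraph (Fin n)).edgeSet), (∀ᶠ n : ℕ in atTop, (C n).IsOver B2 ∧ (C n).size ≤ s n) ∧ Tendsto (fun n : ℕ => (erdosRenyiHalf n).toOuterMeasure {x | (C n).eval x = true} + (plantedCliqueDist n ⌈(n : ℝ) ^ (1 / 2 - δ)⌉₊).toOuterMeasure {x | (C n).eval x = false}) atTop (nhds 0) :=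
  fun _ hδ hδ' s hs => karlinRubin_no_detector_of_small_budget hδ hδ' s hs

end Summit.PneNP.PneNP.Theorems
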